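import Summits.PneNP.PneNP.Theorems.NegLimitedSparseLadderRung

/-!
# Route NegLimited — item `NeglimitedInverseLinearNegations` (stmt-PneNP-19681, rung R10-B) PROVED with its explicit type

The support item stmt-PneNP-19681 of route PneNP/NegLimited (cell pnp-ideate, rung F-N1/p3, line
`sparse-ladder`, skeleton sha dee521b8 — all four registered stubs landed:
`NegLimitedSparseLadderRelativePow`, `…Advantage`, `…Tradeoff`, `…Rung`): ONE explicit `NP` language with
monotone slices beats size `n^c` against De Morgan circuits with `⌊log₂ n⌋ / (48c+78)` NOT gates, for EVERY
`c`, infinitely often — the INVERSE-LINEAR rate of the negation ladder (`ε·log₂ n` negations force size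
`n^{Ω(1/ε)}`), which implies the closed rung stmt-PneNP-19555 (`⌊log₂ n⌋ / w(n)` for every `w → ∞`).

The theorem below carries the item's signature as its explicit type (the route file
`Theses/NegLimited.lean` has not yet been re-rendered with the declaration `NeglimitedInverseLinearNegations`;
the proof term is the landed `NegLimitedSparseLadder.neglimitedInverseLinearNegations_holds`, whose statement
is the same formula).  Mechanism: the ROUND-9 density ladder run with Rossman's SPARSE dose
(`thm1_sparse_relative` with accuracy `n^{-1/2}`: `NegLimitedSparseLadderRelativePow.lean`), telescoping union
law (`…Advantage.lean`), Amano–Maruoka cover + union bound + first moment (`…Tradeoff.lean`, R10-A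
`neglimitedCliqueSparseTradeoff_holds`: `CLIQUE(n, 8c+17)` needs `≥ n^c` gates against `⌊log₂ n⌋/(8c+18)`
negations), recurring padded clique language (`…Rung.lean`).  Honest scope: NOT the door stmt-PneNP-19860
(`ε log n` for ONE `ε` and all `c`); a restricted-model (negation-limited) lower bound, nothing toward P vs NP.
-/

set_option linter.dupNamespace false -- `Summit.PneNP.PneNP.…`: summit = sub-problem name (D-0017 single-conjunct layout)

namespace Summit.PneNP.PneNP.Theorems

/-- **Item stmt-PneNP-19681 (`NegLimited.NeglimitedInverseLinearNegations`, rung R10-B of line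
`sparse-ladder`) PROVED, with its explicit type**: there is an `NP` language `L` such that for every `c`,
infinitely often the slice `L_n` is monotone and needs more than `n^c` De Morgan gates when only
`⌊log₂ n⌋ / (48c+78)` NOT gates are allowed. -/
theorem neglimitedInverseLinearNegations_holds :
    ∃ L ∈ Literature.Computability.Complexity.Nondeterministic.NP, ∀ c : ℕ, ∃ᶠ n : ℕ in Filter.atTop, Monotone (L.sliceFn n) ∧ n ^ c < Literature.Computability.Complexity.negLimitedSizeOver Literature.Computability.Complexity.deMorganBasis (Nat.log 2 n / (48 * c + 78)) (L.sliceFn n) :=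
  NegLimitedSparseLadder.neglimitedInverseLinearNegations_holds

end Summit.PneNP.PneNP.Theorems
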